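import Literature.AlgebraicGeometry.Resolution.StrictTransform
import Literature.AlgebraicGeometry.Resolution.AlterationsBlowupDivisorProofs
import Mathlib.AlgebraicGeometry.Morphisms.SchemeTheoreticallyDominant
import HarnessLib

/-!
# Flattening of the strict transform (de Jong 1996, 2.18–2.19; Raynaud–Gruson 1971, Thm. 5.2.2)

Topic: `Literature/AlgebraicGeometry/Resolution`. Companion of `StrictTransform.lean`, which defines
de Jong's strict transform `X' ⊂ X ×_S S'` of `f : X → S` along `ψ : S' → S` (`S'` integral) as
the scheme-theoretic closure of the generic fibre of `X ×_S S' → S'`. This file PROVES de Jong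
1996, 2.19 (flattening of the strict transform by a modification) from Raynaud–Gruson's
flattening theorem. De Jong, 2.19 (pp. 60–61): "We recall some arguments from [22, p. 36-37].
Let `f : X → S` be a projective morphism of Noetherian schemes. We assume `S` integral. Let
`U ⊂ S` be a nonempty open subscheme over which `f` is flat […]. We claim that there exists a
modification `ψ : S' → S` with center in `S ∖ U` such that the strict transform `f' : X' → S'`
of `f` is flat. […] Anyway, we can deal with arbitrary morphisms `f` of finite type (`S`
Noetherian) by invoking [22, Theorem 5.2.2]." ([22] = Raynaud–Gruson 1971.) This file carries
out that last sentence: 2.19, in the form used in 4.18 over a field, is the PROVED theorem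
`DeJong1996.flattening_of_stacks081R`, conditional only on Raynaud–Gruson's flattening theorem,
vendored as the named fact `Stacks081R` (the Stacks Project's statement, Tag 081R); everything
else is proved. (History, D-0026: 2.19 was first vendored as a named fact `DeJong1996Flattening`
in `StrictTransform.lean`; that intermediate fact has been MERGED into this proved theorem, so
the only literature debt below de Jong 2.19 is the single leaf `Stacks081R`.)

## Content

* `isSchemeTheoreticallyDominant_fiberι_genericPoint` — PROVED: the generic fibre of a flat
  `Y → S'`, `S'` integral, is schematically dense in `Y` (flat base change of the quasi-compact,
  scheme-theoretically dominant `Spec κ(η') → S'`; Liu 2002, proof of Prop. 4.3.8).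
* `eq_ker_fiberι_genericPoint_of_flat`, `strictTransform_unique`,
  `strictTransform_unique_of_forall_ideal_eq_bot` — PROVED: **de Jong 1996, 2.18, last
  sentence** ("if `X''` is closed in `X ×_S S'`, flat over `S'` and equal to `X ×_S S'` over a
  nonempty open part of `S'`, then […] `X'' = X'`"), as an equality of ideal sheaves of
  `X ×_S S'`: `J ≤ ker` because the generic fibre lies in `(X ×_S S')|_V ⊂ X''`; `ker ≤ J`
  because the generic fibre of the flat `X''` is schematically dense in `X''`.
* `blowupStrictTransform f b I` (with `…ι`, `…Map`) — DEFINITION (Stacks, Tag 080D (2)): the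
  strict transform of `X → S` along a blowing up `b : S' → S` of `S` in `V(I)`, the closed
  subscheme of `X ×_S S'` cut out by the sections supported on the pull-back of the exceptional
  divisor, i.e. the scheme-theoretic closure of `(X ×_S S')|_{b⁻¹(S ∖ V(I))}`;
  `ker_blowupStrictTransformι_eq_ker_strictTransformι`: for `S'` integral it agrees with de
  Jong's `X'` as soon as it is flat over `S'` (2.18).
* `Stacks081R` — NAMED FACT (Raynaud–Gruson 1971, Thm. 5.2.2, in the form Stacks 081R): for `S`
  qcqs, `U ⊆ S` quasi-compact open, `X → S` of finite type and quasi-separated, flat and locally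
  of finite presentation over `U`, there is a `U`-admissible blowing up `S' → S` (blowing up in
  an ideal of finite type with support disjoint from `U`, Stacks 080K) whose strict transform is
  flat and of finite presentation over `S'`. Its discharge is a theory of its own — SIZE XL: the
  printed proofs are Raynaud–Gruson, Première partie, §§2–5 (dévissage, modules purs, "plat en
  dimension ≥ n", platificateurs) resp. Stacks, More on Flatness: one-step and complete dévissage
  (Tags 05H3, 05HG), pure modules (05BB), flattening functors (05MG), flattening a map (05PC),
  Theorem 0815 (flattening a module by a `U`-admissible blow-up, §080X) and Lemma 081R, over
  Divisors §§080C, 080J (strict transforms, admissible blow-ups); de Jong's own argument for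
  projective `f` needs the Hilbert scheme `Hilb_P(X/S)` (FGA), equally absent from Mathlib — and
  is NOT attempted here. It is the single leaf below de Jong 2.19 and is not to be cut further
  (D-0026: decompositions do not recurse); a future discharge `stacks081R_holds` makes 2.19
  unconditional at once.
* `DeJong1996.flattening_of_stacks081R` — PROVED: **de Jong 1996, 2.19 (in the form used in 4.18,
  over a field) from `Stacks081R`**. `S` a projective variety and `X` projective over `k`: `S` is
  Noetherian and separated, so [22, 5.2.2] applies; the blowing up `ψ : S' → S` in `I ≠ 0` (the
  centre misses the non-empty `U`) is a modification (`IsModification.of_isBlowup`: Stacks 02ND,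
  02NS, 02OS), an isomorphism over `U` (`IsBlowup.isIso_morphismRestrict`), `S'` is projective
  over `k` (`IsBlowup.isProjectiveOver`, Hartshorne II.7.16 (c)), and by 2.18 the flat strict
  transform of Stacks 080D is `X'`.

So de Jong 2.19 rests on the single named fact `Stacks081R`: users who need the flattening take
`(h : Stacks081R)` and call `DeJong1996.flattening_of_stacks081R h`.

## Sources

* A. J. de Jong, *Smoothness, semi-stability and alterations*, Publ. Math. IHÉS 83 (1996) 51–93:
  2.18, 2.19 (pp. 60–61), 4.18 (p. 72). [DeJong1996]
* M. Raynaud, L. Gruson, *Critères de platitude et de projectivité*, Invent. Math. 13 (1971)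
  1–89, Première partie, Thm. 5.2.2. [RaynaudGruson1971]
* The Stacks Project, Tags 080D (strict transform), 080K (admissible blowups), 0815, 081R
  (flattening by blowing up), 01R8 (scheme-theoretic image), 02ND, 02NS, 02OS. [StacksProject]
* Q. Liu, *Algebraic Geometry and Arithmetic Curves* (2002), Lemma 4.3.7, Prop. 4.3.8. [Liu2002]
-/

noncomputable section

open CategoryTheory CategoryTheory.Limits AlgebraicGeometry TopologicalSpace Topology

namespace Literature.AlgebraicGeometry.Resolution

universe u

/-! ## The generic fibre of a flat scheme over an integral base is schematically dense -/

section GenericFibre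

variable {Y S' : Scheme.{u}}

/-- `Spec κ(s) → S` is quasi-compact (its source is a one-point space). [folklore] -/
theorem quasiCompact_fromSpecResidueField (S : Scheme.{u}) (s : S) :
    QuasiCompact (S.fromSpecResidueField s) :=
  haveI : Finite ↥(Spec (S.residueField s)) :=
    inferInstanceAs (Finite (PrimeSpectrum (S.residueField s)))
  ⟨fun _ _ _ ↦ (Set.toFinite _).isCompact⟩

/-- On an integral scheme, `Spec κ(η) → S` (η the generic point) is dominant. [folklore] -/
theorem isDominant_fromSpecResidueField_genericPoint (S : Scheme.{u}) [IsIntegral S] :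
    IsDominant (S.fromSpecResidueField (genericPoint S)) := by
  rw [isDominant_iff, DenseRange, Scheme.range_fromSpecResidueField, dense_iff_closure_eq]
  exact (genericPoint_spec S).def

/-- On an integral scheme, `Spec κ(η) → S` is scheme-theoretically dominant (its kernel ideal
sheaf vanishes: a quasi-compact dominant morphism to a reduced scheme). [folklore] -/
theorem isSchemeTheoreticallyDominant_fromSpecResidueField_genericPoint (S : Scheme.{u})
    [IsIntegral S] : IsSchemeTheoreticallyDominant (S.fromSpecResidueField (genericPoint S)) :=
  haveI := quasiCompact_fromSpecResidueField S (genericPoint S)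
  haveI := isDominant_fromSpecResidueField_genericPoint S
  IsSchemeTheoreticallyDominant.of_isDominant _

/-- **The generic fibre of a flat morphism to an integral scheme is schematically dense**: for
`g : Y → S'` flat and `S'` integral, the inclusion `Y_{η'} → Y` of the scheme-theoretic generic
fibre has zero kernel (flat base change of the scheme-theoretically dominant quasi-compact
`Spec κ(η') → S'`; affine-locally: a flat module over a domain is torsion free, Liu 2002,
proof of Prop. 4.3.8). [folklore] -/
theorem isSchemeTheoreticallyDominant_fiberι_genericPoint [IsIntegral S'] (g : Y ⟶ S') [Flat g] :
    IsSchemeTheoreticallyDominant (g.fiberι (genericPoint S')) := by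
  haveI := quasiCompact_fromSpecResidueField S' (genericPoint S')
  haveI := isSchemeTheoreticallyDominant_fromSpecResidueField_genericPoint S'
  delta Scheme.Hom.fiberι Scheme.Hom.fiber
  infer_instance

/-- Hence the kernel ideal sheaf of `Y_{η'} → Y` is `⊥` for `Y` flat over the integral `S'`.
[folklore] -/
theorem ker_fiberι_genericPoint_eq_bot [IsIntegral S'] (g : Y ⟶ S') [Flat g] :
    (g.fiberι (genericPoint S')).ker = ⊥ :=
  (isSchemeTheoreticallyDominant_fiberι_genericPoint g).ker_eq_bot

end GenericFibre

/-! ## de Jong 1996, 2.18: uniqueness of the strict transform -/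

section Uniqueness

variable {Y S' : Scheme.{u}} [IsIntegral S'] (g : Y ⟶ S') (J : Y.IdealSheafData)

/-- A closed subscheme `Z'' = V(J)` of `Y` containing the schematic closure of `Y|_{g⁻¹V}` for a
non-empty open `V ⊆ S'` contains the schematic closure of the generic fibre of `Y → S'`:
`J ≤ ker(Y_{η'} → Y)` (the generic fibre factors through the open `g⁻¹V ∋ η'`). [folklore] -/
theorem le_ker_fiberι_genericPoint_of_le_ker_ι (V : S'.Opens) (hV : (V : Set S').Nonempty)
    (hJ : J ≤ (g ⁻¹ᵁ V).ι.ker) : J ≤ (g.fiberι (genericPoint S')).ker := by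
  have hη : genericPoint S' ∈ V :=
    ((genericPoint_spec S').mem_open_set_iff V.2).mpr (by simpa using hV)
  have hrange : Set.range (g.fiberι (genericPoint S')) ⊆ Set.range (g ⁻¹ᵁ V).ι := by
    rw [Scheme.Hom.range_fiberι, Scheme.Opens.range_ι]
    rintro x (hx : g x = genericPoint S')
    show g x ∈ V
    rwa [hx]
  rw [← IsOpenImmersion.lift_fac (g ⁻¹ᵁ V).ι (g.fiberι (genericPoint S')) hrange]
  exact hJ.trans (Scheme.Hom.le_ker_comp _ _)

/-- A section of the structure sheaf all of whose germs vanish is zero. [folklore] -/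
theorem section_eq_zero_of_forall_germ_eq_zero {Z : Scheme.{u}} (V : Z.Opens) (s : Γ(Z, V))
    (h : ∀ (z : Z) (hz : z ∈ V), Z.presheaf.germ V z hz s = 0) : s = 0 := by
  apply TopCat.Presheaf.section_ext Z.sheaf V s 0
  intro z hz
  change Z.presheaf.germ V z hz s = Z.presheaf.germ V z hz 0
  rw [map_zero]
  exact h z hz

/-- "`Z'' = V(J)` equals `Y` over the open `O ⊆ Y`" — `J(W) = 0` for every affine open `W ⊆ O`
— implies that `Z''` contains the schematic closure of `O` in `Y`: `J ≤ ker(O ↪ Y)`. [folklore] -/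
theorem le_ker_ι_of_forall_ideal_eq_bot (O : Y.Opens)
    (hJ : ∀ W : Y.affineOpens, (W : Y.Opens) ≤ O → J.ideal W = ⊥) : J ≤ O.ι.ker := by
  change J ≤ Scheme.IdealSheafData.ofIdeals _
  rw [Scheme.IdealSheafData.le_ofIdeals_iff]
  intro W x hx
  change x ∈ RingHom.ker (O.ι.app W).hom
  rw [RingHom.mem_ker, Scheme.Opens.ι_app]
  apply section_eq_zero_of_forall_germ_eq_zero (Z := Y) (V := O.ι ''ᵁ (O.ι ⁻¹ᵁ W))
  rintro _ ⟨z, hz, rfl⟩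
  change (Y.presheaf.germ _ (O.ι z) _).hom ((Y.presheaf.map (homOfLE _).op).hom x) = 0
  rw [← RingHom.comp_apply, ← CommRingCat.hom_comp, TopCat.Presheaf.germ_res]
  -- an affine neighbourhood of `z` inside `W ∩ O`, on which `J` vanishes
  obtain ⟨W', hW', hzW', hW'le⟩ := exists_isAffineOpen_mem_and_subset (X := Y) (x := O.ι z)
    (U := (W : Y.Opens) ⊓ O) ⟨hz, z.2⟩
  have hle : W' ≤ (W : Y.Opens) := fun w hw => (hW'le hw).1
  have hres : (Y.presheaf.map (homOfLE hle).op).hom x = 0 := by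
    have hmem := J.ideal_le_comap_ideal (U := ⟨W', hW'⟩) (V := W) hle hx
    rw [Ideal.mem_comap, hJ ⟨W', hW'⟩ (fun w hw => (hW'le hw).2), Ideal.mem_bot] at hmem
    exact hmem
  rw [← TopCat.Presheaf.germ_res Y.presheaf (homOfLE hle) (O.ι z) hzW', CommRingCat.hom_comp,
    RingHom.comp_apply, hres, map_zero]

/-- A closed subscheme `Z'' = V(J)` of `Y`, flat over the integral `S'`, is contained in the
schematic closure of the generic fibre of `Y → S'`: `ker(Y_{η'} → Y) ≤ J` (the generic fibre of
`Z''` is schematically dense in `Z''` and maps to the generic fibre of `Y`). [folklore] -/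
theorem ker_fiberι_genericPoint_le_of_flat [Flat (J.subschemeι ≫ g)] :
    (g.fiberι (genericPoint S')).ker ≤ J := by
  set η := genericPoint S'
  let m : (J.subschemeι ≫ g).fiber η ⟶ g.fiber η :=
    pullback.map (J.subschemeι ≫ g) (S'.fromSpecResidueField η) g (S'.fromSpecResidueField η)
      J.subschemeι (𝟙 _) (𝟙 _) (by simp) (by simp)
  have hm : m ≫ g.fiberι η = (J.subschemeι ≫ g).fiberι η ≫ J.subschemeι :=
    pullback.lift_fst _ _ _
  calc (g.fiberι η).ker ≤ (m ≫ g.fiberι η).ker := Scheme.Hom.le_ker_comp _ _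
    _ = ((J.subschemeι ≫ g).fiberι η ≫ J.subschemeι).ker := by rw [hm]
    _ = J := by
      rw [Scheme.Hom.ker_comp, ker_fiberι_genericPoint_eq_bot, Scheme.IdealSheafData.map_bot,
        Scheme.IdealSheafData.ker_subschemeι]

/-- **de Jong 1996, 2.18, last sentence (uniqueness of the strict transform), for a general
`Y → S'`**: a closed subscheme `Z'' = V(J)` of `Y`, flat over the integral `S'` and containing
(the schematic closure of) `Y|_{g⁻¹V}` for some non-empty open `V ⊆ S'`, IS the schematic closure
of the generic fibre: `J = ker(Y_{η'} → Y)`. [cite: DeJong1996, 2.18, p. 60] -/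
theorem eq_ker_fiberι_genericPoint_of_flat [Flat (J.subschemeι ≫ g)] (V : S'.Opens)
    (hV : (V : Set S').Nonempty) (hJ : J ≤ (g ⁻¹ᵁ V).ι.ker) :
    J = (g.fiberι (genericPoint S')).ker :=
  le_antisymm (le_ker_fiberι_genericPoint_of_le_ker_ι g J V hV hJ)
    (ker_fiberι_genericPoint_le_of_flat g J)

end Uniqueness

/-! ## de Jong 1996, 2.18: uniqueness of the strict transform `X' ⊂ X ×_S S'` -/

section StrictTransformUnique

variable {X S S' : Scheme.{u}} (f : X ⟶ S) (ψ : S' ⟶ S) [IsIntegral S']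

/-- The kernel ideal sheaf of `X' ↪ X ×_S S'` is the kernel of the inclusion of the generic fibre
of `X ×_S S' → S'` (the strict transform is its scheme-theoretic image). [folklore] -/
theorem ker_strictTransformι :
    (strictTransformι f ψ).ker = ((pullback.snd f ψ).fiberι (genericPoint S')).ker :=
  Scheme.IdealSheafData.ker_subschemeι _

/-- **de Jong 1996, 2.18, last sentence: uniqueness of the strict transform.** "Finally, if `X''`
is closed in `X ×_S S'`, flat over `S'` and equal to `X ×_S S'` over a nonempty open part of `S'`,
then it equals the schematic closure of `X ×_S ψ⁻¹(U)` and hence equals the strict transform of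
`X`, i.e. `X'' = X'`." Rendered on ideal sheaves of `X ×_S S'`: if the closed subscheme `V(J)` is
flat over `S'` and contains the schematic closure of `(X ×_S S')|_{V}` for a non-empty open
`V ⊆ S'` (in particular if it equals `X ×_S S'` over `V`), then `J` is the ideal sheaf of
`X' ↪ X ×_S S'`. No hypothesis on `ψ`, `f` or `S` is needed. [cite: DeJong1996, 2.18, p. 60] -/
theorem strictTransform_unique (J : (pullback f ψ).IdealSheafData)
    [Flat (J.subschemeι ≫ pullback.snd f ψ)] (V : S'.Opens) (hV : (V : Set S').Nonempty)
    (hJ : J ≤ ((pullback.snd f ψ) ⁻¹ᵁ V).ι.ker) : J = (strictTransformι f ψ).ker := by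
  rw [ker_strictTransformι]
  exact eq_ker_fiberι_genericPoint_of_flat (pullback.snd f ψ) J V hV hJ

/-- `strictTransform_unique` with "equal to `X ×_S S'` over a nonempty open part `V` of `S'`"
rendered literally: the ideal sheaf `J` of `X''` vanishes on every affine open of `X ×_S S'` lying
over `V`. [cite: DeJong1996, 2.18, p. 60] -/
theorem strictTransform_unique_of_forall_ideal_eq_bot (J : (pullback f ψ).IdealSheafData)
    [Flat (J.subschemeι ≫ pullback.snd f ψ)] (V : S'.Opens) (hV : (V : Set S').Nonempty)
    (hJ : ∀ W : (pullback f ψ).affineOpens,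
      (W : (pullback f ψ).Opens) ≤ (pullback.snd f ψ) ⁻¹ᵁ V → J.ideal W = ⊥) :
    J = (strictTransformι f ψ).ker :=
  strictTransform_unique f ψ J V hV (le_ker_ι_of_forall_ideal_eq_bot J _ hJ)

end StrictTransformUnique

/-! ## Strict transforms along blow-ups (Stacks 080D) and flattening (Stacks 081R) -/

section BlowupStrictTransform

variable {X S S' : Scheme.{u}} (f : X ⟶ S) (b : S' ⟶ S) (I : S.IdealSheafData)

/-- **The strict transform of `X → S` with respect to the blowing up `b : S' → S` of `S` in
`Z = V(I)`** (Stacks, Tag 080D (2)): "the closed subscheme `X' ⊂ X ×_S S'` cut out by the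
quasi-coherent ideal of sections of `𝒪_{X ×_S S'}` supported on `pr_{S'}⁻¹ E`", `E = b⁻¹ Z` the
exceptional divisor. A section is supported on the closed set `pr_{S'}⁻¹ E` iff it restricts to
zero on the open complement `pr_{S'}⁻¹(S' ∖ E) = (X ×_S S') ×_{S'} b⁻¹(S ∖ V(I))`, so this ideal
is the kernel of the restriction to that open, and — the open being retrocompact (loc. cit.:
"`pr_{S'}⁻¹ E ⊂ X ×_S S'` is locally principal […] Thus the complement […] is retrocompact") —
`X'` is the scheme-theoretic image (Mathlib `Scheme.Hom.image`, Stacks 01R7–01R8) of the open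
immersion `(X ×_S S')|_{pr⁻¹(S' ∖ E)} ↪ X ×_S S'`, which is how it is rendered here (for an
arbitrary `b`, the centre entering only through `S ∖ V(I)` = `centreCompl I`).
[cite: StacksProject, Tag 080D] -/
def blowupStrictTransform : Scheme.{u} :=
  ((pullback.snd f b) ⁻¹ᵁ (b ⁻¹ᵁ centreCompl I)).ι.image

/-- The closed immersion `X' ↪ X ×_S S'` of the strict transform along a blowing up
(Stacks, Tag 080D (2)). [cite: StacksProject, Tag 080D] -/
def blowupStrictTransformι : blowupStrictTransform f b I ⟶ pullback f b :=
  ((pullback.snd f b) ⁻¹ᵁ (b ⁻¹ᵁ centreCompl I)).ι.imageι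

/-- The structure morphism `X' → S'` of the strict transform along a blowing up `S' → S`
(Stacks, Tag 080D). [cite: StacksProject, Tag 080D] -/
def blowupStrictTransformMap : blowupStrictTransform f b I ⟶ S' :=
  blowupStrictTransformι f b I ≫ pullback.snd f b

/-- `X' ↪ X ×_S S'` is a closed immersion. [folklore] -/
instance isClosedImmersion_blowupStrictTransformι :
    IsClosedImmersion (blowupStrictTransformι f b I) :=
  inferInstanceAs
    (IsClosedImmersion ((pullback.snd f b) ⁻¹ᵁ (b ⁻¹ᵁ centreCompl I)).ι.ker.subschemeι)

/-- Unfolding `blowupStrictTransformMap`. [folklore] -/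
theorem blowupStrictTransformι_snd :
    blowupStrictTransformι f b I ≫ pullback.snd f b = blowupStrictTransformMap f b I :=
  rfl

/-- The ideal sheaf of `X' ↪ X ×_S S'` is the kernel of the restriction to the open over
`S' ∖ E`. [folklore] -/
theorem ker_blowupStrictTransformι :
    (blowupStrictTransformι f b I).ker = ((pullback.snd f b) ⁻¹ᵁ (b ⁻¹ᵁ centreCompl I)).ι.ker :=
  Scheme.IdealSheafData.ker_subschemeι _

/-- **Along a blowing up of an integral scheme in a centre `≠ S`, the strict transform of
Stacks 080D is de Jong's strict transform 2.18 as soon as it is flat over `S'`** (de Jong 1996,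
2.18, last sentence): both are closed subschemes of `X ×_S S'`, the former is flat over the
integral `S'` and equals `X ×_S S'` over the non-empty open `b⁻¹(S ∖ V(I))`.
[cite: DeJong1996, 2.18, p. 60] -/
theorem ker_blowupStrictTransformι_eq_ker_strictTransformι [IsIntegral S']
    (hne : ((b ⁻¹ᵁ centreCompl I : S'.Opens) : Set S').Nonempty)
    [Flat (blowupStrictTransformMap f b I)] :
    (blowupStrictTransformι f b I).ker = (strictTransformι f b).ker := by
  haveI : Flat (((pullback.snd f b) ⁻¹ᵁ (b ⁻¹ᵁ centreCompl I)).ι.ker.subschemeι ≫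
      pullback.snd f b) := ‹Flat (blowupStrictTransformMap f b I)›
  rw [ker_blowupStrictTransformι]
  exact strictTransform_unique f b _ (b ⁻¹ᵁ centreCompl I) hne le_rfl

/-- Hence, in that situation, de Jong's strict transform `f' : X' → S'` is flat.
[cite: DeJong1996, 2.18–2.19, pp. 60–61] -/
theorem flat_strictTransformMap_of_flat_blowupStrictTransformMap [IsIntegral S']
    (hne : ((b ⁻¹ᵁ centreCompl I : S'.Opens) : Set S').Nonempty)
    [Flat (blowupStrictTransformMap f b I)] : Flat (strictTransformMap f b) := by
  have key := ker_blowupStrictTransformι_eq_ker_strictTransformι f b I hne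
  rw [ker_blowupStrictTransformι, ker_strictTransformι] at key
  have hflat : Flat (((pullback.snd f b) ⁻¹ᵁ (b ⁻¹ᵁ centreCompl I)).ι.ker.subschemeι ≫
      pullback.snd f b) := ‹Flat (blowupStrictTransformMap f b I)›
  rw [key] at hflat
  exact hflat

end BlowupStrictTransform

/-- NAMED FACT — **Raynaud–Gruson 1971, Thm. 5.2.2 (flattening by blowing up), in the form of
the Stacks Project, Tag 081R (for schemes; Tag 0815 for modules).** Stacks 081R: "Let `S` be a
quasi-compact and quasi-separated scheme. Let `X` be a scheme over `S`. Let `U ⊂ S` be a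
quasi-compact open. Assume (1) `X → S` is of finite type and quasi-separated, and (2) `X_U → U` is
flat and locally of finite presentation. Then there exists a `U`-admissible blowup `S' → S` such
that the strict transform of `X` is flat and of finite presentation over `S'`." Here a
`U`-admissible blowup (Stacks, Tag 080K: "there exists a closed immersion `Z → X` of finite
presentation with `Z` disjoint from `U` such that `X'` is isomorphic to the blowup of `X` in `Z`";
`Z → S` of finite presentation iff its ideal sheaf is of finite type, loc. cit.) is rendered by an
ideal sheaf `I` of finite type (`I(W)` finitely generated for every affine open `W`) whose support
is disjoint from `U`, and a blowing up `b : S' → S` of `S` along `I` in the sense of the universal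
property (`IsBlowup`, unique up to unique isomorphism); the strict transform is
`blowupStrictTransform` (Tag 080D) with structure map `blowupStrictTransformMap f b I : X' → S'`,
asserted flat and locally of finite presentation (it is automatically quasi-compact and
quasi-separated, `X' → X ×_S S'` being a closed immersion and `f` of finite type and
quasi-separated, so "of finite presentation" as printed). This is the result de Jong 1996, 2.19
invokes as "[22, Theorem 5.2.2]" (Raynaud–Gruson 1971, Première partie, Thm. 5.2.2; the Stacks
Project's chapter *More on Flatness* "can be found in the paper [GR71]"). Users take
`(h : Stacks081R)` (Raynaud–Gruson: [RaynaudGruson1971], Thm. 5.2.2). [cite: StacksProject, Tag 081R] -/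
def Stacks081R : Prop :=
  ∀ ⦃X S : Scheme.{u}⦄ (f : X ⟶ S) [CompactSpace S] [QuasiSeparatedSpace S] [QuasiCompact f]
    [LocallyOfFiniteType f] [QuasiSeparated f] (U : S.Opens), IsCompact (U : Set S) →
    Flat (f ∣_ U) → LocallyOfFinitePresentation (f ∣_ U) →
    ∃ (I : S.IdealSheafData) (S' : Scheme.{u}) (b : S' ⟶ S),
      (∀ W : S.affineOpens, (I.ideal W).FG) ∧ Disjoint (U : Set S) (I.support : Set S) ∧
      IsBlowup b I ∧ Flat (blowupStrictTransformMap f b I) ∧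
      LocallyOfFinitePresentation (blowupStrictTransformMap f b I)

/-! ## de Jong 1996, 2.19 from Raynaud–Gruson -/

/-- **de Jong 1996, 2.19 (flattening of the strict transform by a modification), in the form
used in 4.18 over a field, PROVED from Raynaud–Gruson 1971, Thm. 5.2.2 (`Stacks081R`).**
De Jong, 2.19: "Let `f : X → S` be a projective morphism of Noetherian schemes. We assume `S`
integral. Let `U ⊂ S` be a nonempty open subscheme over which `f` is flat; such exist, see 2.7.
We claim that there exists a modification `ψ : S' → S` with center in `S ∖ U` such that the
strict transform `f' : X' → S'` of `f` is flat. […] Indeed, we can take `S'` to be the schematic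
closure of `U ↪ Hilb`. […] Anyway, we can deal with arbitrary morphisms `f` of finite type (`S`
Noetherian) by invoking [22, Theorem 5.2.2]." Rendered over a field `k` (the case of 4.18): `S`
an integral scheme projective over `k`, `X` projective over `k` (so that `f` is projective),
`U ⊆ S` a non-empty open with `f|_U` flat; conclusion: an integral `S'`, projective over `k`, and
a modification `ψ : S' → S` over `k` (`IsModification`, 2.17) which is an isomorphism over `U`
("center in `S ∖ U`") such that the strict transform `strictTransformMap f ψ : X' → S'` (2.18) is
flat. Proof, following de Jong's last sentence: `S` is a projective variety, hence Noetherian,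
quasi-compact and separated, `U` is quasi-compact, `f` is of finite type and separated and `f|_U`
is of finite presentation; [22, 5.2.2] gives a blowing up `ψ : S' → S` in an ideal `I ≠ 0` of
finite type with `V(I) ∩ U = ∅` whose strict transform (Stacks 080D) is flat. Then `S'` is
integral (Stacks 02ND) and projective over `k` (Hartshorne II.7.16 (c),
`IsBlowup.isProjectiveOver`), `ψ` is a modification (`IsModification.of_isBlowup`) and an
isomorphism over `U ⊆ S ∖ V(I)` (Stacks 02OS), and by the uniqueness in 2.18
(`strictTransform_unique`) the flat strict transform of Stacks 080D is the strict transform `X'`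
of 2.18, so `f' : X' → S'` is flat. The hypothesis `(h081R : Stacks081R)` is the only
undischarged input (this theorem replaces the former named fact `DeJong1996Flattening`, whose
statement is exactly its conclusion). [cite: DeJong1996, 2.19, pp. 60–61] -/
theorem DeJong1996.flattening_of_stacks081R (h081R : Stacks081R.{u}) (k : Type u) [Field k]
    (X S : Scheme.{u}) [IsIntegral S] (f : X ⟶ S) (g : S ⟶ Spec (.of k)) (U : S.Opens)
    (hS : Literature.AlgebraicGeometry.Motives.IsProjectiveOver (Over.mk g))
    (hX : Literature.AlgebraicGeometry.Motives.IsProjectiveOver (Over.mk (f ≫ g)))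
    (hU : (U : Set S).Nonempty) (hflat : Flat (f ∣_ U)) :
    ∃ (S' : Scheme.{u}) (_ : IsIntegral S') (ψ : S' ⟶ S),
      Literature.AlgebraicGeometry.Motives.IsProjectiveOver (Over.mk (ψ ≫ g)) ∧
        IsModification ψ ∧ IsIso (ψ ∣_ U) ∧ Flat (strictTransformMap f ψ) := by
  haveI : IsProper g := Literature.AlgebraicGeometry.Motives.IsProjectiveOver.isProper
    (X := Over.mk g) hS
  haveI : IsProper (f ≫ g) := Literature.AlgebraicGeometry.Motives.IsProjectiveOver.isProper
    (X := Over.mk (f ≫ g)) hX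
  haveI : IsSeparated f := IsSeparated.of_comp f g
  haveI : LocallyOfFiniteType f := locallyOfFiniteType_of_comp f g
  haveI : QuasiCompact f := QuasiCompact.of_comp f g
  haveI : CompactSpace S := QuasiCompact.compactSpace_of_compactSpace g
  haveI : QuasiSeparatedSpace S := quasiSeparatedSpace_of_quasiSeparated g
  haveI : IsLocallyNoetherian S := LocallyOfFiniteType.isLocallyNoetherian g
  haveI : IsNoetherian S := { }
  have hUc : IsCompact (U : Set S) := NoetherianSpace.isCompact _
  haveI : LocallyOfFinitePresentation (f ∣_ U) := inferInstance
  obtain ⟨I, S', b, -, hdisj, hb, hflat', -⟩ := h081R f U hUc hflat inferInstance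
  -- the centre misses the non-empty `U`, so `I ≠ 0`
  have hUle : (U : Set S) ⊆ (centreCompl I : S.Opens) := hdisj.subset_compl_right
  have hI : I ≠ ⊥ := by
    rintro rfl
    obtain ⟨u, hu⟩ := hU
    have := hUle hu
    simp [centreCompl] at this
  haveI : IsIntegral S' := hb.isIntegral hI
  -- `b` is an isomorphism over `S ∖ V(I) ⊇ U`; in particular `b⁻¹(S ∖ V(I))` is non-empty
  haveI hiso : IsIso (b ∣_ centreCompl I) := hb.isIso_compl
  have hne : ((b ⁻¹ᵁ centreCompl I : S'.Opens) : Set S').Nonempty := by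
    obtain ⟨u, hu⟩ := hU
    obtain ⟨p, -⟩ := (Scheme.homeoOfIso (asIso (b ∣_ centreCompl I))).surjective ⟨u, hUle hu⟩
    exact ⟨p.1, p.2⟩
  haveI := hflat'
  exact ⟨S', inferInstance, b, hb.isProjectiveOver g hS, IsModification.of_isBlowup hb hI,
    hb.isIso_morphismRestrict hdisj,
    flat_strictTransformMap_of_flat_blowupStrictTransformMap f b I hne⟩

end Literature.AlgebraicGeometry.Resolution

end
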